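import Summits.QuantumAdvantage.QuantumAdvantage.Theorems.NearExactIsExact.Negative.SkewProductCore

/-!
# `NearExactIsExact` (stmt-QuantumAdvantage-14043) — negative lemma: the REFLECTED FLAT PAIR
  (gen 42 disprover; a three-line, census-free death certificate for the whole K-frame model of the
  `naff = 5`, `E = 0` stratum of BQ-11 — THEOREM CENSUS-K of DISPROOF.md §47.32 without computation)

**Duality.** A quadratic frame `π` with a quadratic translation is dead for every cubic pair
(`c₁ ⊕ c₂∘π ≠ 1_U`) iff some `Φ : 𝔽₂^n → 𝔽₂` is orthogonal to the cubics on the source, `π_*Φ` is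
orthogonal to the cubics on the target, and `Φ` has odd mass on the residual flat `U` (§48.10(d)).
THEOREM OZ / ON exhibit such `Φ` on `r + 1` sections with quadratic weights.  An exact search for the
SPARSEST section-supported certificate on the K-frames of §47.25/47.32 (folder `kcert/kcert_probe.py`,
`kcert_verify.py`: mixing classes of rank `A = 1, 2, 3`, random quadratic `p`; negative controls with an
achievable residual infeasible, as duality demands) returned, in every case, a certificate of weight 64
with CONSTANT weights on TWO affine 5-flats: the zero section `S₀ = {(ū, 0)}` and its reflection
`S₁ = {(ū, K(ū)⁻¹e₀)}` through the target direction `e₀ ∉ H`.  Read back, this is the lemma below.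

**THEOREM (reflected flat pair, `reflected_flat_pair`).** Let `π : 𝔽₂^n → 𝔽₂^n` be any map,
`c₁, c₂` cubic with `c₁ ⊕ c₂∘π = U`.  Suppose `σ₀, σ₁ : 𝔽₂⁵ → 𝔽₂^n` are AFFINE (parametrised 5-flats, or
degenerate ones), `π∘σ₀` is quadratic, and `π∘σ₁ = π∘σ₀ ⊕ e` for a constant `e`.  Then
`#{v : U(σ₀ v)} + #{v : U(σ₁ v)}` is even.  Proof: summing the residual identity over both flats,
`Σ_v c₁(σ₀v)` and `Σ_v c₁(σ₁v)` vanish (cubics on 5 variables) and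
`Σ_v [c₂(πσ₀v) ⊕ c₂(πσ₀v ⊕ e)] = Σ_v (Δ_e c₂)(πσ₀ v)` vanishes (degree `≤ 2·2 = 4 < 5`, Ax).  ∎

**COROLLARY (`kframe_empty`): every K-frame is empty, uniformly in `p`.**  In the K-model of §47.25
(`π(ū,s) = (ū, p(ū) ⊕ K(ū)s)` on `𝔽₂^{5+6}`, `K(0) = I`, residual `[ū = 0][s₀ = 0]`), as soon as the single
section `t(ū) := K(ū)⁻¹e₀` through the target direction `e₀ = e_{s₀}` is affine — true for EVERY
inversion-linear `K`, i.e. for all 20 658 `(L,H)`-classes of S-K6, mixing or not, U or not — there is no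
cubic pair with that residual, for any quadratic `p`: take `σ₀(v) = (v,0)`, `σ₁(v) = (v, t v)`; `S₀` meets
`U` in the origin only and `S₁` misses `U` (`t(0) = e₀` has `s₀ = 1`).  So THEOREM CENSUS-K (5 472 mixing
non-U classes × symbolic `p`, kit j236413–6), the K-model instances of THEOREM U and of the cube-Z
censuses, and the `E = 0` clause of §47.32's corollary are corollaries of a census-free parity lemma; in
the 6+5 language of §46.3(iv) the second flat is `{(ū, 1, M(ū)⁻¹∂₅B(ū))}`, affine exactly by the
translation half (TS) of two-sidedness — which is why the one-sided THEOREM OZ needed `r + 1` sections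
instead.  The lemma is stated for arbitrary `n` and arbitrary `π` so that the `naff ≤ 4` strata can use it
with 5-flats transversal to the preserved coordinates.

HONEST FRAMING: the value here is a THEOREM (a kernel-checked negative lemma that replaces a computational
census of the last Maiorana–McFarland habitat of `NearExactIsExact` by a three-line proof), NOT summit
progress; the `E ≠ 0` mixing frames (GAMMA-CENSUS-19), `naff ≤ 4` and `naff = 0`, the crux and the summit
are untouched.
-/

set_option linter.dupNamespace false -- D-0017: single-problem summit ⇒ `QuantumAdvantage.QuantumAdvantage` by design

namespace Summit.QuantumAdvantage.QuantumAdvantage.Theorems.NearExactIsExact.Negative.ReflectedFlatPair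

open Finset
open Literature.Computability.QuantumComplexity
open Literature.Computability.QuantumComplexity.BuzetChailloux (bxor)
open Summit.QuantumAdvantage.QuantumAdvantage.Theorems.CubicForrelation.NearExactIsExact
  (fc_isDegLeFun_comp fc_sum_signOf_eq_card stub_axParity stub_derivDegree)
open Summit.QuantumAdvantage.QuantumAdvantage.Theorems.NearExactIsExact.Negative.BqqSeven
  (natCast_eq_zero_of_even)
open Summit.QuantumAdvantage.QuantumAdvantage.Theorems.NearExactIsExact.Negative.SkewProductCore

/-- Ax / McEliece at `n = 5`, `d = 4`: a Boolean function of degree `≤ 4` on `5` bits has even weight.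
[folklore] -/
theorem even_card_of_deg_four {F : (Fin 5 → Bool) → Bool} (hF : IsDegLeFun 4 F) :
    Even ((univ.filter fun x : Fin 5 → Bool => F x = true).card) := by
  obtain ⟨z, hz⟩ := stub_axParity 5 4 F univ (by norm_num) hF
  rw [filter_true_of_mem (fun u _ i _ => mem_univ i), card_fin, fc_sum_signOf_eq_card] at hz
  have h4 : (2 : ℝ) ^ ((5 + 4 - 1) / 4) = 4 := by norm_num
  rw [h4] at hz
  have hc : (((univ.filter fun x : Fin 5 → Bool => F x = true).card : ℤ) : ℝ) =
      ((2 * (8 - z) : ℤ) : ℝ) := by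
    push_cast
    linear_combination (-(1 : ℝ) / 2) * hz
  have he : Even (((univ.filter fun x : Fin 5 → Bool => F x = true).card : ℤ)) :=
    ⟨8 - z, by rw [Int.cast_injective hc]; ring⟩
  exact (Int.even_coe_nat _).mp he

/-- Degree `≤ 4` on `5` bits ⇒ `Σ_x ind (F x) = 0`. [folklore] -/
theorem sum_ind_eq_zero_of_deg_four {F : (Fin 5 → Bool) → Bool} (hF : IsDegLeFun 4 F) :
    ∑ x, ind (F x) = 0 := by
  rw [sum_ind]
  exact natCast_eq_zero_of_even (even_card_of_deg_four hF)

/-- **REFLECTED FLAT PAIR.** If `c₁ ⊕ c₂∘π = U` with `c₁, c₂` cubic, `σ₀, σ₁ : 𝔽₂⁵ → 𝔽₂^n` affine,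
`π∘σ₀` quadratic and `π∘σ₁ = π∘σ₀ ⊕ e`, then `U` has even total mass on the two flats. [folklore] -/
theorem reflected_flat_pair {n : ℕ} (π : (Fin n → Bool) → (Fin n → Bool))
    (c₁ c₂ : (Fin n → Bool) → Bool) (h₁ : IsDegLeFun 3 c₁) (h₂ : IsDegLeFun 3 c₂)
    (U : (Fin n → Bool) → Bool) (hres : ∀ z, (c₁ z ^^ c₂ (π z)) = U z)
    (σ₀ σ₁ : (Fin 5 → Bool) → (Fin n → Bool))
    (hσ₀ : ∀ j, IsDegLeFun 1 (fun v => σ₀ v j)) (hσ₁ : ∀ j, IsDegLeFun 1 (fun v => σ₁ v j))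
    (hπ : ∀ j, IsDegLeFun 2 (fun v => π (σ₀ v) j)) (e : Fin n → Bool)
    (hrefl : ∀ v, π (σ₁ v) = bxor (π (σ₀ v)) e) :
    ∑ v, ind (U (σ₀ v)) + ∑ v, ind (U (σ₁ v)) = 0 := by
  have hc0 : IsDegLeFun 3 (fun v : Fin 5 → Bool => c₁ (σ₀ v)) :=
    fc_isDegLeFun_comp h₁ σ₀ hσ₀ (by norm_num)
  have hc1 : IsDegLeFun 3 (fun v : Fin 5 → Bool => c₁ (σ₁ v)) :=
    fc_isDegLeFun_comp h₁ σ₁ hσ₁ (by norm_num)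
  have hD : IsDegLeFun 4 (fun v : Fin 5 → Bool => c₂ (π (σ₀ v)) ^^ c₂ (bxor (π (σ₀ v)) e)) :=
    fc_isDegLeFun_comp (stub_derivDegree n 2 c₂ e h₂) (fun v => π (σ₀ v)) hπ (by norm_num)
  have hpt : ∀ v : Fin 5 → Bool, ind (U (σ₀ v)) + ind (U (σ₁ v)) =
      ind (c₁ (σ₀ v)) + ind (c₁ (σ₁ v)) + ind (c₂ (π (σ₀ v)) ^^ c₂ (bxor (π (σ₀ v)) e)) := by
    intro v
    rw [← hres (σ₀ v), ← hres (σ₁ v), hrefl v, ind_xor, ind_xor, ind_xor]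
    ring
  rw [← sum_add_distrib, sum_congr rfl (fun v _ => hpt v), sum_add_distrib, sum_add_distrib,
    sum_ind_eq_zero_of_deg_four (hc0.mono (by norm_num)),
    sum_ind_eq_zero_of_deg_four (hc1.mono (by norm_num)), sum_ind_eq_zero_of_deg_four hD, add_zero,
    add_zero]

/-- Coordinates of a graph flat `v ↦ (v, t v)` with `t` affine are affine. [folklore] -/
theorem graphFlat_coord_deg {m r : ℕ} (t : (Fin m → Bool) → Fin r → Bool)
    (ht : ∀ k, IsDegLeFun 1 (fun v => t v k)) :
    ∀ j : Fin (m + r), IsDegLeFun 1 (fun v : Fin m → Bool => Fin.append v (t v) j) := by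
  intro j
  induction j using Fin.addCases with
  | left i =>
    have e : (fun v : Fin m → Bool => Fin.append v (t v) (Fin.castAdd r i)) = fun v => v i :=
      funext fun v => Fin.append_left v _ i
    rw [e]; exact isDegLeFun_apply i le_rfl
  | right k =>
    have e : (fun v : Fin m → Bool => Fin.append v (t v) (Fin.natAdd m k)) = fun v => t v k :=
      funext fun v => Fin.append_right v _ k
    rw [e]; exact ht k

/-- **Every K-frame is empty (THEOREM CENSUS-K census-free).** K-model of §47.25: source
`(ū, s) ∈ 𝔽₂^{5+6}`, residual `[ū = 0][s₀ = 0]`; if the zero section has a quadratic image and ONE affine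
section `t` with `t(0)_{0} = 1` is the reflection of the zero section through a constant target vector
`e` (for `π(ū,s) = (ū, p ū ⊕ K(ū)s)`: `t = K⁻¹e_{s₀}`, affine for every inversion-linear `K`), then no
cubic pair has that residual. [folklore] -/
theorem kframe_empty (π : (Fin (5 + 6) → Bool) → (Fin (5 + 6) → Bool))
    (c₁ c₂ : (Fin (5 + 6) → Bool) → Bool) (h₁ : IsDegLeFun 3 c₁) (h₂ : IsDegLeFun 3 c₂)
    (hres : ∀ z, (c₁ z ^^ c₂ (π z)) =
      (decide (∀ i : Fin 5, z (Fin.castAdd 6 i) = false) && !z (Fin.natAdd 5 0)))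
    (hπ : ∀ j, IsDegLeFun 2 (fun v : Fin 5 → Bool => π (Fin.append v (fun _ => false)) j))
    (t : (Fin 5 → Bool) → Fin 6 → Bool) (ht : ∀ k, IsDegLeFun 1 (fun v => t v k))
    (ht0 : t (fun _ => false) 0 = true) (e : Fin (5 + 6) → Bool)
    (hrefl : ∀ v, π (Fin.append v (t v)) = bxor (π (Fin.append v (fun _ => false))) e) :
    False := by
  have h := reflected_flat_pair π c₁ c₂ h₁ h₂ _ hres (fun v => Fin.append v (fun _ => false))
    (fun v => Fin.append v (t v))
    (graphFlat_coord_deg (fun _ _ => false) (fun _ => isDegLeFun_const 1 false))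
    (graphFlat_coord_deg t ht) hπ e hrefl
  -- mass: the zero flat meets `U` exactly in the origin, the reflected flat misses it
  have h0 : ∑ v : Fin 5 → Bool, ind (decide (∀ i : Fin 5,
      Fin.append v (fun _ : Fin 6 => false) (Fin.castAdd 6 i) = false) &&
        !Fin.append v (fun _ : Fin 6 => false) (Fin.natAdd 5 0)) = 1 := by
    simp only [Fin.append_left, Fin.append_right, Bool.not_false, Bool.and_true]
    rw [Finset.sum_eq_single (fun _ => false)]
    · simp
    · intro u _ hu
      have hu' : ¬ ∀ i, u i = false := fun h' => hu (funext h')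
      simp [hu']
    · intro h'
      exact absurd (mem_univ _) h'
  have h1 : ∑ v : Fin 5 → Bool, ind (decide (∀ i : Fin 5,
      Fin.append v (t v) (Fin.castAdd 6 i) = false) && !Fin.append v (t v) (Fin.natAdd 5 0)) = 0 := by
    refine sum_eq_zero fun v _ => ?_
    simp only [Fin.append_left, Fin.append_right]
    by_cases hv : ∀ i, v i = false
    · have ev : v = fun _ => false := funext hv
      subst ev
      rw [ht0]; simp
    · simp [hv]
  rw [h0, h1, add_zero] at h
  exact one_ne_zero h

end Summit.QuantumAdvantage.QuantumAdvantage.Theorems.NearExactIsExact.Negative.ReflectedFlatPair
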